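import Mathlib.Data.Fintype.Basic
import Mathlib.Data.Fintype.Prod
import Mathlib.Data.Fintype.Sigma
import Mathlib.Data.Fintype.Sum
import Mathlib.Data.List.Basic
import Mathlib.Tactic.DeriveFintype
import HarnessLib

/-!
# Ollinger's self-coding aperiodic set of 104 Wang tiles

N. Ollinger, *Two-by-two substitution systems and the undecidability of the Domino Problem*
(CiE 2008, LNCS 5028), §3 "An aperiodic tile set of 104 tiles": a tile set `τ` with three layers
that **codes** an unambiguous `2 × 2` substitution `s : τ → τ^{2×2}` — every tiling is, up to a
translation in `{0,1}²`, the image under `s` of a tiling — and is therefore aperiodic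
(Ollinger, Prop. 4 and Thm. 1; Jeandel–Vanier, LNM 2273, §3.2 Def. 10 / Prop. 8: "intrinsically
substitutive"). This file contains the tile set and the FINITE facts about it; tilings,
decomposition, aperiodicity and the gluing property are in the companion files.

## The tile set (reconstruction of the printed description)

A tile has a *parity* `l ∈ {0,1}²` (layer 1: the four tiles of `τ₀`, forcing a grouping of any
tiling into `2 × 2` blocks) and a *core* (layers 2 and 3) of one of three kinds: a corner
`X q` (`q ∈ {0,1}²`: which corner of a square of wires), a horizontal transmitter `H h d ν` or a
vertical transmitter `V v d η`; `h, v, ν, η ∈ {0,1}²` are pairs of wires and `d` is the bit of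
layer 3 ("on which side of the edge one can find the nearest corner"). Each side of a core carries
*edge data* (a pair of wires and a direction bit, `Core.east` …); the Wang colour of a side of a
tile is (parity colour, edge data). The *wire colour constraint* (`Core.wcc`: "if one of the
orthogonal wires is coloured `11`, the direction has to point inside the `11` boundary") and the
*synchronisation* of parities with kinds (`X` on parities `00, 11`; `H` on `00, 10`; `V` on
`00, 01`) define the good tiles (`Tile.good`): `8` X-tiles, `48` H-tiles, `48` V-tiles, `104` in
all (`card_goodTile`), the printed counts. The substitution (`subst r a`, `r ∈ {0,1}²`): in
position `00` the tile `a` with parity reset to `00`; in position `11` the corner `X (a.l)`; in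
position `10` an H-tile propagating the east edge data of `a`; in position `01` a V-tile
propagating its north edge data (Ollinger §3, "The associated substitution rule `s` transforms a
tile `a` as follows …").

## Finite facts (kernel-decided)

`good_subst` (the image of a good tile consists of good tiles: "the image of a tile is always
defined as the wire color constraint is always satisfied"), `hmatch_subst`/`vmatch_subst` (the four
inside edges of an image match), `hmatch_iff_blocks`/`vmatch_iff_blocks` (**matching transfer**:
`a, b` match iff `s(a), s(b)` match — both directions, the heart of "`τ` codes `s`"),
`subst_injective`, the corner tile `xstar = (11, X 11)` with `subst 11 xstar = xstar` and
`subst 11 (subst 11 b) = xstar` for every `b`, and the **block decoding** lemmas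
(`decode_h`, `decode_v`, `decode_good_or_bad`, `not_bad_v_below`, `not_bad_h_left`): an internally
matching block on parities `[01 11 / 00 10]` is `s(q, c)` for the corner type `q` of its `11`-cell
and the core `c` of its `00`-cell, and `(q, c)` is a good tile except for two families, each of
which is excluded by the two cells below, resp. to the left of, the block (one cell of context;
Ollinger: "thanks to the wire color constraint, `u · T|□` has to be the image of a tile by `s`").

## References

* N. Ollinger, *Two-by-two Substitution Systems and the Undecidability of the Domino Problem*,
  CiE 2008, LNCS 5028, 476–485, doi:10.1007/978-3-540-69407-6_51, §§1–3.
* E. Jeandel, P. Vanier, *The Undecidability of the Domino Problem*, LNM 2273 (2020), §3.2.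
-/

namespace Literature.Dynamics.Tilings.Ollinger

/-- Two bits (an element of Ollinger's `τ₀ = {00, 10, 01, 11}`; also a pair of wires).
[cite: Ollinger2008, §2 Example 4] -/
abbrev B2 : Type := Bool × Bool

/-- Edge data of a side of a core: a pair of wires and the layer-3 direction bit (`true` = the
nearest corner is to the east / north of this edge). [cite: Ollinger2008, §3] -/
abbrev EData : Type := B2 × Bool

/-- **Cores** (layers 2–3 of a tile): a corner `X q` of type `q` ("4 different corners"), a
horizontal transmitter `H h d ν` (propagates the edge data `(h, d)` from west to east, carries the
vertical wires `ν`), a vertical transmitter `V v d η`. [cite: Ollinger2008, §3] -/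
inductive Core : Type
  | X (q : B2)
  | H (h : B2) (d : Bool) (ν : B2)
  | V (v : B2) (d : Bool) (η : B2)
  deriving DecidableEq, Fintype, Repr

/-- A **tile**: a parity `l` (layer 1) and a core. [cite: Ollinger2008, §3] -/
structure Tile : Type where
  /-- layer 1: the parity class of the cell -/
  l : B2
  /-- layers 2 and 3 -/
  c : Core
  deriving DecidableEq, Fintype, Repr

namespace Core

/-- Edge data on the east side. Corners: all directions point inside (`X`: east edge says "corner
to the west" = `false`); `H` relays `(h, d)`; `V`: side edges point outside.
[cite: Ollinger2008, §3] -/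
def east : Core → EData
  | X q => ((!q.1, q.2), false)
  | H h d _ => (h, d)
  | V _ _ η => (η, true)

/-- Edge data on the west side. [cite: Ollinger2008, §3] -/
def west : Core → EData
  | X q => ((q.1, q.2), true)
  | H h d _ => (h, d)
  | V _ _ η => (η, false)

/-- Edge data on the north side. [cite: Ollinger2008, §3] -/
def north : Core → EData
  | X q => ((!q.2, q.1), false)
  | H _ _ ν => (ν, true)
  | V v d _ => (v, d)

/-- Edge data on the south side. [cite: Ollinger2008, §3] -/
def south : Core → EData
  | X q => ((q.2, q.1), true)
  | H _ _ ν => (ν, false)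
  | V v d _ => (v, d)

/-- **Wire colour constraint**: for a transmitter whose orthogonal wires signal a square side
(`ν.1 = true`), the relayed direction must point inside the square ("if one of the orthogonal
wires is colored `11`, the direction has to point inside the `11` boundary"); `16` of the `64`
H-tiles and of the V-tiles are thereby removed. [cite: Ollinger2008, §3] -/
def wcc : Core → Bool
  | X _ => true
  | H _ d ν => !ν.1 || (d == !ν.2)
  | V _ d η => !η.1 || (d == !η.2)

end Core

namespace Tile

/-- **The tile set `τ`**: wire colour constraint plus the synchronisation between layers
(X-cores on parities `00, 11`, H-cores on `00, 10`, V-cores on `00, 01`).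
[cite: Ollinger2008, §3] -/
def good (t : Tile) : Bool :=
  t.c.wcc &&
    match t.l, t.c with
    | (false, false), _ => true
    | (true, true), .X _ => true
    | (true, false), .H _ _ _ => true
    | (false, true), .V _ _ _ => true
    | _, _ => false

/-- East colour of the parity layer (`τ₀`: the east neighbour has the other `x`-parity).
[cite: Ollinger2008, §2 Example 4] -/
def lE (l : B2) : B2 := (!l.1, l.2)

/-- North colour of the parity layer. [cite: Ollinger2008, §2 Example 4] -/
def lN (l : B2) : B2 := (l.1, !l.2)

/-- `a` (west) and `b` (east) **match horizontally**: parities alternate and the east edge data of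
`a` is the west edge data of `b` ("match the colors of the facing wires" and agree on the
direction). [cite: Ollinger2008, §§2–3] -/
def hmatch (a b : Tile) : Bool := (lE a.l == b.l) && (a.c.east == b.c.west)

/-- `a` (south) and `b` (north) **match vertically**. [cite: Ollinger2008, §§2–3] -/
def vmatch (a b : Tile) : Bool := (lN a.l == b.l) && (a.c.north == b.c.south)

end Tile

/-! ### Exhaustive lists (for kernel-decided facts) -/

/-- The four pairs of bits. [folklore] -/
def allB2 : List B2 := [(false, false), (true, false), (false, true), (true, true)]

/-- Every pair of bits is listed. [folklore] -/
theorem mem_allB2 (x : B2) : x ∈ allB2 := by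
  obtain ⟨_ | _, _ | _⟩ := x <;> simp [allB2]

/-- All `68` cores. [cite: Ollinger2008, §3] -/
def allCore : List Core :=
  allB2.map Core.X ++
    (allB2.flatMap fun h => [false, true].flatMap fun d => allB2.map fun ν => Core.H h d ν) ++
    (allB2.flatMap fun v => [false, true].flatMap fun d => allB2.map fun η => Core.V v d η)

/-- Every core is listed. [folklore] -/
theorem mem_allCore (c : Core) : c ∈ allCore := by
  cases c with
  | X q => simp [allCore, mem_allB2]
  | H h d ν =>
    simp only [allCore, List.mem_append, List.mem_flatMap, List.mem_map]
    exact Or.inl (Or.inr ⟨h, mem_allB2 h, d, by cases d <;> simp, ν, mem_allB2 ν, rfl⟩)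
  | V v d η =>
    simp only [allCore, List.mem_append, List.mem_flatMap, List.mem_map]
    exact Or.inr ⟨v, mem_allB2 v, d, by cases d <;> simp, η, mem_allB2 η, rfl⟩

/-- All `272` tiles (good or not). [folklore] -/
def allTile : List Tile := allB2.flatMap fun l => allCore.map fun c => ⟨l, c⟩

/-- Every tile is listed. [folklore] -/
theorem mem_allTile (t : Tile) : t ∈ allTile := by
  obtain ⟨l, c⟩ := t
  simp only [allTile, List.mem_flatMap, List.mem_map]
  exact ⟨l, mem_allB2 l, c, mem_allCore c, rfl⟩

/-- **The tile set `τ` as a list.** [cite: Ollinger2008, §3] -/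
def allGood : List Tile := allTile.filter Tile.good

/-- A good tile is listed in `allGood`. [folklore] -/
theorem mem_allGood {t : Tile} (ht : t.good = true) : t ∈ allGood :=
  List.mem_filter.mpr ⟨mem_allTile t, ht⟩

/-- **`τ` has `104` tiles**: `8` X-tiles, `48` H-tiles, `48` V-tiles — the printed counts.
[cite: Ollinger2008, §3] -/
theorem length_allGood : allGood.length = 104 ∧
    (allGood.filter fun t => match t.c with | .X _ => true | _ => false).length = 8 ∧
    (allGood.filter fun t => match t.c with | .H _ _ _ => true | _ => false).length = 48 ∧
    (allGood.filter fun t => match t.c with | .V _ _ _ => true | _ => false).length = 48 := by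
  decide +kernel

/-- From a kernel-decided `List.all` over the good tiles to a statement about every good tile.
[folklore] -/
theorem of_allGood_all {P : Tile → Bool} (h : allGood.all P = true) {a : Tile}
    (ha : a.good = true) : P a = true :=
  List.all_eq_true.mp h a (mem_allGood ha)

/-! ### The substitution -/

open Tile

/-- **The substitution `s`**, cell `r ∈ {0,1}²` of the image of `a` (`r = (x, y)`, `x` to the
east, `y` to the north): `00 ↦` the tile `a` with parity `00`; `11 ↦` the corner `X (a.l)`;
`10 ↦` the H-tile relaying the east edge data of `a`, with vertical wires `(a.l.2, a.l.1)`;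
`01 ↦` the V-tile relaying the north edge data of `a`, with horizontal wires `a.l`.
[cite: Ollinger2008, §3] -/
def subst (r : B2) (a : Tile) : Tile :=
  match r with
  | (false, false) => ⟨(false, false), a.c⟩
  | (true, false) => ⟨(true, false), .H a.c.east.1 a.c.east.2 (a.l.2, a.l.1)⟩
  | (false, true) => ⟨(false, true), .V a.c.north.1 a.c.north.2 a.l⟩
  | (true, true) => ⟨(true, true), .X a.l⟩

/-- The parity of cell `r` of an image is `r`. [cite: Ollinger2008, §3] -/
@[simp] theorem subst_l (r : B2) (a : Tile) : (subst r a).l = r := by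
  obtain ⟨_ | _, _ | _⟩ := r <;> rfl

/-- The `00`-cell of the image of `a` carries the core of `a`. [cite: Ollinger2008, §3] -/
@[simp] theorem subst_zero_c (a : Tile) : (subst (false, false) a).c = a.c := rfl

/-- The `11`-cell of the image of `a` is the corner of type the parity of `a`. [cite: Ollinger2008, §3] -/
@[simp] theorem subst_oneone (a : Tile) : subst (true, true) a = ⟨(true, true), .X a.l⟩ := rfl

/-- **The image of a good tile consists of good tiles** ("the image of a tile is always defined as
the wire color constraint is always satisfied"). [cite: Ollinger2008, §3] -/
theorem good_subst {a : Tile} (ha : a.good = true) (r : B2) : (subst r a).good = true := by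
  have h : (allGood.all fun a => allB2.all fun r => (subst r a).good) = true := by
    decide +kernel
  exact List.all_eq_true.mp (of_allGood_all h ha) r (mem_allB2 r)

/-- The two inside vertical edges of an image match. [cite: Ollinger2008, §3 (proof of Thm. 1)] -/
theorem hmatch_subst {a : Tile} (ha : a.good = true) :
    hmatch (subst (false, false) a) (subst (true, false) a) = true ∧
      hmatch (subst (false, true) a) (subst (true, true) a) = true := by
  have h : (allGood.all fun a => hmatch (subst (false, false) a) (subst (true, false) a) &&
      hmatch (subst (false, true) a) (subst (true, true) a)) = true := by decide +kernel
  simpa [Bool.and_eq_true] using of_allGood_all h ha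

/-- The two inside horizontal edges of an image match. [cite: Ollinger2008, §3 (proof of Thm. 1)] -/
theorem vmatch_subst {a : Tile} (ha : a.good = true) :
    vmatch (subst (false, false) a) (subst (false, true) a) = true ∧
      vmatch (subst (true, false) a) (subst (true, true) a) = true := by
  have h : (allGood.all fun a => vmatch (subst (false, false) a) (subst (false, true) a) &&
      vmatch (subst (true, false) a) (subst (true, true) a)) = true := by decide +kernel
  simpa [Bool.and_eq_true] using of_allGood_all h ha

/-- **Matching transfer, horizontal**: `a, b` match iff their images, put side by side, match
along the common boundary ("if two tiles `a` and `b` match … `s(a)` and `s(b)` will still match …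
if two tile images `s(a)` and `s(b)` match, then `a` and `b` match").
[cite: Ollinger2008, §3 (proof of Thm. 1)] -/
theorem hmatch_iff_blocks {a b : Tile} (ha : a.good = true) (hb : b.good = true) :
    hmatch a b = (hmatch (subst (true, false) a) (subst (false, false) b) &&
      hmatch (subst (true, true) a) (subst (false, true) b)) := by
  have h : (allGood.all fun a => allGood.all fun b => hmatch a b ==
      (hmatch (subst (true, false) a) (subst (false, false) b) &&
        hmatch (subst (true, true) a) (subst (false, true) b))) = true := by decide +kernel
  exact beq_iff_eq.mp (of_allGood_all (of_allGood_all h ha) hb)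

/-- **Matching transfer, vertical**. [cite: Ollinger2008, §3 (proof of Thm. 1)] -/
theorem vmatch_iff_blocks {a b : Tile} (ha : a.good = true) (hb : b.good = true) :
    vmatch a b = (vmatch (subst (false, true) a) (subst (false, false) b) &&
      vmatch (subst (true, true) a) (subst (true, false) b)) := by
  have h : (allGood.all fun a => allGood.all fun b => vmatch a b ==
      (vmatch (subst (false, true) a) (subst (false, false) b) &&
        vmatch (subst (true, true) a) (subst (true, false) b))) = true := by decide +kernel
  exact beq_iff_eq.mp (of_allGood_all (of_allGood_all h ha) hb)

/-- `s` is injective: `a` is read off its image (core in cell `00`, parity in cell `11`).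
[cite: Ollinger2008, §3 (proof of Thm. 1: "it is clearly injective")] -/
theorem subst_injective {a b : Tile} (h00 : subst (false, false) a = subst (false, false) b)
    (h11 : subst (true, true) a = subst (true, true) b) : a = b := by
  obtain ⟨la, ca⟩ := a
  obtain ⟨lb, cb⟩ := b
  simp only [subst, Tile.mk.injEq, true_and, Core.X.injEq] at h00 h11
  rw [h00, h11]

/-- The four projectors have disjoint images (their parities differ): the substitution is
unambiguous in Ollinger's syntactic sense. [cite: Ollinger2008, §1 (before §2) and §3] -/
theorem subst_ne_of_ne {r r' : B2} (h : r ≠ r') (a b : Tile) : subst r a ≠ subst r' b := by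
  intro he
  have := congrArg Tile.l he
  rw [subst_l, subst_l] at this
  exact h this

/-! ### The corner tile -/

/-- The **corner tile** `x* = (11, X 11)`: the cell `11` of its own image.
[cite: Ollinger2008, §3] -/
def xstar : Tile := ⟨(true, true), .X (true, true)⟩

/-- `x*` is a good tile. [cite: Ollinger2008, §3] -/
theorem good_xstar : xstar.good = true := by decide

/-- `x*` is the top-right cell of its image (so its supertiles are nested). [cite: Ollinger2008, §3] -/
@[simp] theorem subst_xstar : subst (true, true) xstar = xstar := rfl

/-- The top-right cell of the top-right cell of the image of ANY tile is `x*` (so `x*`, and its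
supertiles, occur at the same place in every supertile of order `≥ 2`). [cite: Ollinger2008, §3] -/
theorem subst_subst_oneone (b : Tile) : subst (true, true) (subst (true, true) b) = xstar :=
  rfl

/-! ### Decoding a block -/

/-- In an internally matching block on parities `[01 11 / 00 10]`, the `10`-cell is the H-tile of
the image of `(q, c)`, `q` the corner type of the `11`-cell and `c` the core of the `00`-cell.
[cite: Ollinger2008, §3 (proof of Thm. 1)] -/
theorem decode_h (c : Core) {p10 : Tile} (q : B2) (hg : p10.good = true)
    (hl : p10.l = (true, false)) (h1 : hmatch ⟨(false, false), c⟩ p10 = true)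
    (h2 : vmatch p10 ⟨(true, true), .X q⟩ = true) : p10 = subst (true, false) ⟨q, c⟩ := by
  have h : (allCore.all fun c => allGood.all fun p10 => allB2.all fun q =>
      !(p10.l == (true, false) && hmatch ⟨(false, false), c⟩ p10 &&
          vmatch p10 ⟨(true, true), .X q⟩) ||
        (p10 == subst (true, false) ⟨q, c⟩)) = true := by
    decide +kernel
  have := List.all_eq_true.mp (of_allGood_all (List.all_eq_true.mp h c (mem_allCore c)) hg) q
    (mem_allB2 q)
  simp only [hl, beq_self_eq_true, h1, Bool.and_self, h2, Bool.not_true, Bool.false_or] at this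
  exact beq_iff_eq.mp this

/-- Likewise the `01`-cell is the V-tile of the image of `(q, c)`. [cite: Ollinger2008, §3 (proof of Thm. 1)] -/
theorem decode_v (c : Core) {p01 : Tile} (q : B2) (hg : p01.good = true)
    (hl : p01.l = (false, true)) (h1 : vmatch ⟨(false, false), c⟩ p01 = true)
    (h2 : hmatch p01 ⟨(true, true), .X q⟩ = true) : p01 = subst (false, true) ⟨q, c⟩ := by
  have h : (allCore.all fun c => allGood.all fun p01 => allB2.all fun q =>
      !(p01.l == (false, true) && vmatch ⟨(false, false), c⟩ p01 &&
          hmatch p01 ⟨(true, true), .X q⟩) ||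
        (p01 == subst (false, true) ⟨q, c⟩)) = true := by
    decide +kernel
  have := List.all_eq_true.mp (of_allGood_all (List.all_eq_true.mp h c (mem_allCore c)) hg) q
    (mem_allB2 q)
  simp only [hl, beq_self_eq_true, h1, Bool.and_self, h2, Bool.not_true, Bool.false_or] at this
  exact beq_iff_eq.mp this

/-- The decoded tile is in a **bad family** (not a good tile although its H- and V-cells are):
parity `10` with a V-core relaying "north", or parity `01` with an H-core relaying "east".
[cite: Ollinger2008, §3] -/
def isBad (q : B2) (c : Core) : Bool :=
  match q, c with
  | (true, false), .V _ true _ => true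
  | (false, true), .H _ true _ => true
  | _, _ => false

/-- The bad families, spelled out. [cite: Ollinger2008, §3] -/
theorem isBad_iff (q : B2) (c : Core) : isBad q c = true ↔
    (q = (true, false) ∧ ∃ v η, c = .V v true η) ∨ (q = (false, true) ∧ ∃ h ν, c = .H h true ν) := by
  constructor
  · intro hb
    obtain ⟨_ | _, _ | _⟩ := q <;> cases c with
    | X q' => simp [isBad] at hb
    | H h d ν => cases d <;> simp_all [isBad]
    | V v d η => cases d <;> simp_all [isBad]
  · rintro (⟨rfl, v, η, rfl⟩ | ⟨rfl, h, ν, rfl⟩) <;> rfl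

/-- **Decoding, up to the bad families**: if the core `c` satisfies the wire colour constraint and
the H-cell and the V-cell of the would-be image of `(q, c)` are good tiles, then `(q, c)` is a
good tile or belongs to one of the two bad families. [cite: Ollinger2008, §3 (proof of Thm. 1)] -/
theorem decode_good_or_bad (q : B2) (c : Core) (hwcc : c.wcc = true)
    (h10 : (subst (true, false) ⟨q, c⟩).good = true) (h01 : (subst (false, true) ⟨q, c⟩).good = true) :
    (Tile.mk q c).good = true ∨ isBad q c = true := by
  have h : (allB2.all fun q => allCore.all fun c =>
      !(c.wcc && (subst (true, false) ⟨q, c⟩).good && (subst (false, true) ⟨q, c⟩).good) ||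
        ((Tile.mk q c).good || isBad q c)) = true := by
    decide +kernel
  have := List.all_eq_true.mp (List.all_eq_true.mp h q (mem_allB2 q)) c (mem_allCore c)
  simpa [hwcc, h10, h01] using this

/-- Kernel check behind `not_bad_v_below`. [cite: Ollinger2008, §3 (proof of Thm. 1)] -/
theorem not_bad_v_below_aux : (allB2.all fun v => allB2.all fun η => allB2.all fun vt =>
    [false, true].all fun dt => allB2.all fun ηt => allB2.all fun q =>
      !(Tile.good ⟨(false, true), .V vt dt ηt⟩ && Tile.good ⟨(true, true), .X q⟩ &&
        vmatch ⟨(false, true), .V vt dt ηt⟩ ⟨(false, false), .V v true η⟩ &&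
        hmatch ⟨(false, true), .V vt dt ηt⟩ ⟨(true, true), .X q⟩ &&
        vmatch ⟨(true, true), .X q⟩ (subst (true, false) ⟨(true, false), .V v true η⟩))) = true := by
  decide +kernel

/-- Kernel check behind `not_bad_h_left`. [cite: Ollinger2008, §3 (proof of Thm. 1)] -/
theorem not_bad_h_left_aux : (allB2.all fun h => allB2.all fun ν => allB2.all fun ht' =>
    [false, true].all fun dt => allB2.all fun νt => allB2.all fun q =>
      !(Tile.good ⟨(true, false), .H ht' dt νt⟩ && Tile.good ⟨(true, true), .X q⟩ &&
        hmatch ⟨(true, false), .H ht' dt νt⟩ ⟨(false, false), .H h true ν⟩ &&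
        vmatch ⟨(true, false), .H ht' dt νt⟩ ⟨(true, true), .X q⟩ &&
        hmatch ⟨(true, true), .X q⟩ (subst (false, true) ⟨(false, true), .H h true ν⟩))) = true := by
  decide +kernel

/-- **The first bad family is excluded by the two cells below the block**: below the `00`-cell
`(00, V v true η)` of a block with corner type `10` there is no good tile `t` matching it from
below whose east neighbour `u` (the cell below the H-cell of the block) is a good tile matching
`t` and that H-cell (the corner `u` is then `X 11`, so the V-relay `t` carries the side of its
square and must relay "south", not "north"). [cite: Ollinger2008, §3 (proof of Thm. 1)] -/
theorem not_bad_v_below (v η : B2) (t u : Tile) (ht : t.good = true) (hu : u.good = true)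
    (h1 : vmatch t ⟨(false, false), .V v true η⟩ = true) (h2 : hmatch t u = true)
    (h3 : vmatch u (subst (true, false) ⟨(true, false), .V v true η⟩) = true) : False := by
  obtain ⟨⟨lt1, lt2⟩, ct⟩ := t
  obtain ⟨⟨lu1, lu2⟩, cu⟩ := u
  -- the parities of `t` and `u` are `01` and `11`
  have hl1 : lt1 = false ∧ lt2 = true := by
    simp only [vmatch, lN, Bool.and_eq_true, beq_iff_eq, Prod.mk.injEq] at h1
    obtain ⟨⟨h, h'⟩, -⟩ := h1
    exact ⟨h, by simpa using h'⟩
  obtain ⟨rfl, rfl⟩ := hl1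
  have hl2 : lu1 = true ∧ lu2 = true := by
    simp only [hmatch, lE, Bool.and_eq_true, beq_iff_eq, Prod.mk.injEq] at h2
    obtain ⟨⟨h, h'⟩, -⟩ := h2
    exact ⟨by simpa using h.symm, h'.symm⟩
  obtain ⟨rfl, rfl⟩ := hl2
  -- so `t` is a V-tile and `u` an X-tile; the rest is a finite check on their wires
  cases ct with
  | X q => simp [Tile.good] at ht
  | H h d ν => simp [Tile.good] at ht
  | V vt dt ηt =>
    cases cu with
    | H h d ν => simp [Tile.good] at hu
    | V v' d' η' => simp [Tile.good] at hu
    | X q =>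
      have key := List.all_eq_true.mp (List.all_eq_true.mp (List.all_eq_true.mp
        (List.all_eq_true.mp (List.all_eq_true.mp (List.all_eq_true.mp not_bad_v_below_aux
        v (mem_allB2 v)) η (mem_allB2 η)) vt (mem_allB2 vt)) dt (by cases dt <;> simp))
        ηt (mem_allB2 ηt)) q (mem_allB2 q)
      simp [ht, hu, h1, h2, h3] at key

/-- **The second bad family is excluded by the two cells to the left of the block** (mirror
image of `not_bad_v_below`). [cite: Ollinger2008, §3 (proof of Thm. 1)] -/
theorem not_bad_h_left (h ν : B2) (t u : Tile) (ht : t.good = true) (hu : u.good = true)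
    (h1 : hmatch t ⟨(false, false), .H h true ν⟩ = true) (h2 : vmatch t u = true)
    (h3 : hmatch u (subst (false, true) ⟨(false, true), .H h true ν⟩) = true) : False := by
  obtain ⟨⟨lt1, lt2⟩, ct⟩ := t
  obtain ⟨⟨lu1, lu2⟩, cu⟩ := u
  have hl1 : lt1 = true ∧ lt2 = false := by
    simp only [hmatch, lE, Bool.and_eq_true, beq_iff_eq, Prod.mk.injEq] at h1
    obtain ⟨⟨h, h'⟩, -⟩ := h1
    exact ⟨by simpa using h, h'⟩
  obtain ⟨rfl, rfl⟩ := hl1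
  have hl2 : lu1 = true ∧ lu2 = true := by
    simp only [vmatch, lN, Bool.and_eq_true, beq_iff_eq, Prod.mk.injEq] at h2
    obtain ⟨⟨h, h'⟩, -⟩ := h2
    exact ⟨h.symm, by simpa using h'.symm⟩
  obtain ⟨rfl, rfl⟩ := hl2
  cases ct with
  | X q => simp [Tile.good] at ht
  | V v d η => simp [Tile.good] at ht
  | H ht' dt νt =>
    cases cu with
    | H h' d ν' => simp [Tile.good] at hu
    | V v' d' η' => simp [Tile.good] at hu
    | X q =>
      have key := List.all_eq_true.mp (List.all_eq_true.mp (List.all_eq_true.mp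
        (List.all_eq_true.mp (List.all_eq_true.mp (List.all_eq_true.mp not_bad_h_left_aux
        h (mem_allB2 h)) ν (mem_allB2 ν)) ht' (mem_allB2 ht')) dt (by cases dt <;> simp))
        νt (mem_allB2 νt)) q (mem_allB2 q)
      simp [ht, hu, h1, h2, h3] at key

/-! ### The alphabet -/

/-- The good tiles, as a subtype: the alphabet of the Ollinger subshift. [cite: Ollinger2008, §3] -/
abbrev GoodTile : Type := {t : Tile // t.good = true}

/-- `x*` as a letter of the alphabet. [cite: Ollinger2008, §3] -/
def xstarG : GoodTile := ⟨xstar, good_xstar⟩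

/-- The substitution on the alphabet. [cite: Ollinger2008, §3] -/
def substG (r : B2) (a : GoodTile) : GoodTile := ⟨subst r a.1, good_subst a.2 r⟩

/-- [cite: Ollinger2008, §3] -/
@[simp] theorem substG_val (r : B2) (a : GoodTile) : (substG r a).1 = subst r a.1 := rfl

end Literature.Dynamics.Tilings.Ollinger
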